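import Summits.QuantumFields.YangMills.Theorems.BalabanUVNodesN15KingModelFullPropagatorMixedProfile

/-!
# BalabanUVNodes ∕ N15 — THE KING-MODEL RUNG, CURVED EDITION (PART V-a, sequel): THE POWER LAW OF THE MIXED SECOND DIFFERENCE OF THE FULL `A = 0`
# FLUCTUATION PROPAGATOR — `|N²δ^{(1)}_μδ^{(2)}_νG^η_K(x, y)| ≤ C·((L^K)∕r)^{d+1}` (`x ≠ y`) = King's Prop. 3.7 (3.63) with `|a| = |b| = 1` SUMMED over (2.17),
# the diagonal order `(L^K)^{d+1}`, and the block decay — UNIFORMLY in `K`, the volume and the mass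
# (Track A, DAG node N15 = NE2; FAN-OUT v1.1 §N15 s3 «KING-MODEL RUNG … + the one-line statement of what the curved case adds»)

HONEST FRAMING.  Count-neutral kernel bookkeeping (cell `pub-ymgap`, seat `pub-ymgap-dag-n15-e` g9; `--supports stmt-QuantumFields-20544
--as helper` = K3⁷ `SpineGivenEndpointR13SepCoPH`, WORDS-143).  TEMPLATE LITERATURE, `A = 0`: C. King's scalar U(1)-Higgs MODEL on finite tori ([King1986]
§2.2 p. 653 (2.13)–(2.17), p. 654 (2.20), Prop. 3.7 (3.63) p. 663 «`|D^a_xD^b_yG^η_{(j)}(x, y)| ≤ C(L^jη)^{2−d−|a|−|b|}exp[−δ₀(L^jη)^{−1}|x − y|]`»; King's `d` =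
this file's `d + 1`), NOT Bałaban's covariant objects; the power law below is the (2.17)-SUMMED SHAPE of the `|a| = |b| = 1` clause of (3.63) for King's
(2.13) at `A = 0`, NOT a printed proposition; NE2⁺ is NOT PRINTED and not proved here; NOT a node discharge; nothing continuum ∕ ℝ⁴ ∕ OS ∕ mass-gap ∕ Clay.
0 `sorry`, 0 `def`, standard axioms.

THE POINT.  Part V-a `fullPropDD_profile_unif` bounds the mixed second difference `DD_{μν}G(x, y) = N·(N·[G(x + e_μ, y + e_ν) − G(x, y + e_ν)] − N·[G(x + e_μ, y)
− G(x, y)])` by the level sum `C·Σ_{i<K}(ΛL²)^i·e^{−δ·r·L^i∕N}`, `ΛL² = L^{d+1}`.  THIS FILE sums the levels (part R-b `levelSum_le_powerLaw` at `p = d + 1`,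
`levelSum_le_geom`; part R-d `levelSum_decay_split`):
* `LamL2_eq_pow`; ★★ **`fullPropDD_powerLaw_unif`** (`x ≠ y`: `|DD_{μν}G(x, y)| ≤ C·((L^K)∕r)^{d+1}` — in unit coordinates `C·|x − y|^{−(d+1)}`, the printed
  exponent `2 − d′ − 2` of (3.63): the mixed-derivative UV singularity of the FULL propagator); ★ `fullPropDD_diag_le_unif` (all pairs `≤ C·(L^K)^{d+1}`);
  ★ `fullPropDD_profile_decay_unif` (profile × `e^{−δ|B(x) − B(y)|}`, all pairs).
This is the kernel of [B9]'s (3.44) object `∇_UG∇*_Uλ` at `U ≡ 1`: `≍ |x − y|^{−(d+1)}` is log-divergent in sup norm against a bounded source —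
whence the Hölder norm of `λ` in the printed (3.44) (the sequel `…FullPropagatorMixedOperator`).
WHAT THE CURVED CASE ADDS (one line): the same mixed-derivative power law for `∇_UG_k(U)∇*_U` uniformly over the live window `Reg335`.
HONEST SCOPE.  (i) `A = 0`, periodic b.c., odd `L ≥ 3`, `0 < m² ≤ m₀²`, cubes `2L^e`; (ii) lattice units of level `K`; sup torus distance; (iii) `K ≥ 1`;
every `d ≥ 0`; (iv) one difference in EACH variable only; (v) not Bałaban's `G_k(U)`; not a discharge.
Locators: [King1986] C. King, CMP **102** (1986) 649–677: (2.13)–(2.17) p. 653, (2.20) p. 654, Prop. 3.7 (3.63) p. 663, (4.42)–(4.44) p. 675;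
[Balaban1985BackgroundPropagators] Thm 3.1 (3.44) p. 398 (the object).
-/

noncomputable section

namespace Summit.QuantumFields.YangMills.BalabanUVNodes.N15KingModelRung.Curved

open Real Finset Matrix
open Literature.MathematicalPhysics.QuantumFieldTheory.Balaban1983to89.B5Prop11Plancherel (Tor fine unitVec)
open Literature.MathematicalPhysics.QuantumFieldTheory.King1986 (aK aK_pos)
open Literature.MathematicalPhysics.QuantumFieldTheory.King1986.Torus (constrainedProp blockOf tdistT tdistT_nonneg tdistT_symm)

variable {d : ℕ} (L : ℕ) [NeZero L]

/-! ## §3 The power law `|DD_{μν}G^η_K(x, y)| ≤ C·((L^K)∕r)^{d+1}` for `x ≠ y`, the diagonal order, and the block decay -/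

omit [NeZero L] in
/-- `ΛL² = (L^{d+1}∕L²)·L·L = L^{d+1}`. [cite: King1986, (2.20) p.654] -/
theorem LamL2_eq_pow (hL : 2 ≤ L) : (L : ℝ) ^ (d + 1) / (L : ℝ) ^ 2 * L * L = (L : ℝ) ^ (d + 1) := by
  have hL0 : (L : ℝ) ≠ 0 := by exact_mod_cast (show L ≠ 0 by omega)
  field_simp

/-- **THE POWER LAW OF THE MIXED SECOND DIFFERENCE OF KING'S FULL `A = 0` FLUCTUATION PROPAGATOR**: for odd `L ≥ 3`, `a > 0`, `m₀² ≥ 0` there is `C > 0`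
such that for EVERY `K ≥ 1`, cube `2L^e`, mass `0 < m² ≤ m₀²`, directions `μ, ν` and all fine points `x ≠ y` at fine distance `r`:
`|DD_{μν}G(x, y)| ≤ C·((L^K)∕r)^{d+1}` — in unit coordinates `C·|x − y|^{−(d+1)}`, the printed exponent `(L^jη)^{2−d′−|a|−|b|}` of Prop. 3.7 (3.63) at
`|a| = |b| = 1` (`d′ = d + 1` King's dimension) and the scale `L^jη ≈ |x − y|`: the mixed-derivative UV singularity of the FULL propagator, UNIFORM in `K`,
the volume and the mass (§2 + part R-b `levelSum_le_powerLaw` at `p = d + 1`).  This is the kernel of [B9]'s (3.44) object `∇_UG∇*_Uλ` at `U ≡ 1`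
(log-divergent in sup norm — whence the Hölder norm of `λ` in (3.44); the sequel file).
[cite: King1986, Prop. 3.7 (3.63) p.663, Theorem 3.3 p.655, (2.17) p.653; Balaban1985BackgroundPropagators, (3.44) p.398] -/
theorem fullPropDD_powerLaw_unif (hLodd : Odd L) (hL : 2 ≤ L) {a : ℝ} (ha : 0 < a) {m0sq : ℝ} (hm0 : 0 ≤ m0sq) :
    ∃ C : ℝ, 0 < C ∧ ∀ (K : ℕ), 1 ≤ K → ∀ (N : ℕ) [NeZero N], N = L ^ K →
      ∀ (e : ℕ) (M : Fin (d + 1) → ℕ) [∀ μ, NeZero (M μ)], (∀ μ, M μ = 2 * L ^ e) →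
      ∀ (msq : ℝ), 0 < msq → msq ≤ m0sq → ∀ (μ ν : Fin (d + 1)) (x y : Tor (fine N M)), x ≠ y →
        |(N : ℝ) * ((N : ℝ) * (constrainedProp N M (aK a L K) (((N : ℕ) : ℝ) ^ 2) msq (x + unitVec (fine N M) μ) (y + unitVec (fine N M) ν)
              - constrainedProp N M (aK a L K) (((N : ℕ) : ℝ) ^ 2) msq x (y + unitVec (fine N M) ν))
            - (N : ℝ) * (constrainedProp N M (aK a L K) (((N : ℕ) : ℝ) ^ 2) msq (x + unitVec (fine N M) μ) y
              - constrainedProp N M (aK a L K) (((N : ℕ) : ℝ) ^ 2) msq x y))|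
          ≤ C * (((L : ℝ) ^ K) / tdistT (fine N M) x y) ^ (d + 1) := by
  have hLr : (2 : ℝ) ≤ L := by exact_mod_cast hL
  obtain ⟨C₀, δ, hC₀, hδ, H⟩ := fullPropDD_profile_unif (d := d) L hLodd hL ha hm0
  set Kp : ℝ := (2 * ((d + 1) + 1).factorial / (δ / L) ^ ((d + 1) + 1) + 2) / (L : ℝ) ^ (d + 1) with hKp
  have hδL : 0 < δ / L := div_pos hδ (by positivity)
  have hKp0 : 0 < Kp := by positivity
  refine ⟨C₀ * Kp, mul_pos hC₀ hKp0, ?_⟩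
  intro K hK N _ hN e M _ hM msq hmsq hcap μ ν x y hxy
  have h := H K hK N hN e M hM msq hmsq hcap μ ν x y
  set r : ℝ := tdistT (fine N M) x y with hrdef
  have hr : 1 ≤ r := one_le_tdistT_of_ne (fine N M) hxy
  have hNc : (N : ℝ) = (L : ℝ) ^ K := by rw [hN, Nat.cast_pow]
  have hs : ∑ i ∈ Finset.range K, ((L : ℝ) ^ (d + 1) / (L : ℝ) ^ 2 * L * L) ^ i * Real.exp (-(δ * (r * (L : ℝ) ^ i / (N : ℝ))))
      = ∑ i ∈ Finset.range K, ((L : ℝ) ^ (d + 1)) ^ i * Real.exp (-(δ * (r * (L : ℝ) ^ i / (L : ℝ) ^ K))) :=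
    Finset.sum_congr rfl fun i _ => by rw [LamL2_eq_pow L hL, hNc]
  rw [hs] at h
  have hsum := levelSum_le_powerLaw hLr hδ (by omega : 1 ≤ d + 1) K hr
  calc _ ≤ C₀ * ∑ i ∈ Finset.range K, ((L : ℝ) ^ (d + 1)) ^ i * Real.exp (-(δ * (r * (L : ℝ) ^ i / (L : ℝ) ^ K))) := h
    _ ≤ C₀ * (Kp * (((L : ℝ) ^ K) / r) ^ (d + 1)) := mul_le_mul_of_nonneg_left hsum hC₀.le
    _ = C₀ * Kp * (((L : ℝ) ^ K) / r) ^ (d + 1) := by ring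

/-- **THE DIAGONAL ORDER OF THE MIXED SECOND DIFFERENCE, ALL PAIRS**: `|DD_{μν}G(x, y)| ≤ C·(L^K)^{d+1}` for all `x, y` (§2 + part R-b `levelSum_le_geom`
at `Λ = L^{d+1} ≥ 2`). [cite: King1986, Prop. 3.7 (3.63) p.663, (2.20) p.654] -/
theorem fullPropDD_diag_le_unif (hLodd : Odd L) (hL : 2 ≤ L) {a : ℝ} (ha : 0 < a) {m0sq : ℝ} (hm0 : 0 ≤ m0sq) :
    ∃ C : ℝ, 0 < C ∧ ∀ (K : ℕ), 1 ≤ K → ∀ (N : ℕ) [NeZero N], N = L ^ K →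
      ∀ (e : ℕ) (M : Fin (d + 1) → ℕ) [∀ μ, NeZero (M μ)], (∀ μ, M μ = 2 * L ^ e) →
      ∀ (msq : ℝ), 0 < msq → msq ≤ m0sq → ∀ (μ ν : Fin (d + 1)) (x y : Tor (fine N M)),
        |(N : ℝ) * ((N : ℝ) * (constrainedProp N M (aK a L K) (((N : ℕ) : ℝ) ^ 2) msq (x + unitVec (fine N M) μ) (y + unitVec (fine N M) ν)
              - constrainedProp N M (aK a L K) (((N : ℕ) : ℝ) ^ 2) msq x (y + unitVec (fine N M) ν))
            - (N : ℝ) * (constrainedProp N M (aK a L K) (((N : ℕ) : ℝ) ^ 2) msq (x + unitVec (fine N M) μ) y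
              - constrainedProp N M (aK a L K) (((N : ℕ) : ℝ) ^ 2) msq x y))|
          ≤ C * ((L : ℝ) ^ K) ^ (d + 1) := by
  have hLr : (2 : ℝ) ≤ L := by exact_mod_cast hL
  obtain ⟨C₀, δ, hC₀, hδ, H⟩ := fullPropDD_profile_unif (d := d) L hLodd hL ha hm0
  refine ⟨C₀, hC₀, ?_⟩
  intro K hK N _ hN e M _ hM msq hmsq hcap μ ν x y
  have h := H K hK N hN e M hM msq hmsq hcap μ ν x y
  have hΛ2 : (2 : ℝ) ≤ (L : ℝ) ^ (d + 1) := by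
    calc (2 : ℝ) ≤ L := hLr
      _ = (L : ℝ) ^ 1 := (pow_one _).symm
      _ ≤ (L : ℝ) ^ (d + 1) := pow_le_pow_right₀ (by linarith) (by omega)
  have hw : ∀ i : ℕ, Real.exp (-(δ * (tdistT (fine N M) x y * (L : ℝ) ^ i / (N : ℝ)))) ≤ 1 := fun i => by
    rw [Real.exp_le_one_iff]
    have : 0 ≤ δ * (tdistT (fine N M) x y * (L : ℝ) ^ i / (N : ℝ)) := by
      have := tdistT_nonneg (fine N M) x y; positivity
    linarith
  have hs : ∑ i ∈ Finset.range K, ((L : ℝ) ^ (d + 1) / (L : ℝ) ^ 2 * L * L) ^ i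
        * Real.exp (-(δ * (tdistT (fine N M) x y * (L : ℝ) ^ i / (N : ℝ))))
      ≤ ((L : ℝ) ^ (d + 1)) ^ K := by
    rw [show ((L : ℝ) ^ (d + 1) / (L : ℝ) ^ 2 * L * L) = (L : ℝ) ^ (d + 1) from LamL2_eq_pow L hL]
    exact levelSum_le_geom hΛ2 K (fun i => Real.exp (-(δ * (tdistT (fine N M) x y * (L : ℝ) ^ i / (N : ℝ))))) hw
  calc _ ≤ _ := h
    _ ≤ C₀ * ((L : ℝ) ^ (d + 1)) ^ K := mul_le_mul_of_nonneg_left hs hC₀.le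
    _ = C₀ * ((L : ℝ) ^ K) ^ (d + 1) := by ring

/-- **THE PROFILE × THE BLOCK DECAY, ALL PAIRS**: `|DD_{μν}G(x, y)| ≤ C·(Σ_{i<K}(ΛL²)^i e^{−δ r L^i∕N})·e^{−δ|B(x) − B(y)|_M}` — every level's exponential
already contains the unit-block decay (R-d `levelSum_decay_split` at the halved rate). [cite: King1986, Prop. 3.7 (3.63) p.663, Theorem 3.3 (3.7) p.656] -/
theorem fullPropDD_profile_decay_unif (hLodd : Odd L) (hL : 2 ≤ L) {a : ℝ} (ha : 0 < a) {m0sq : ℝ} (hm0 : 0 ≤ m0sq) :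
    ∃ C δ : ℝ, 0 < C ∧ 0 < δ ∧ ∀ (K : ℕ), 1 ≤ K → ∀ (N : ℕ) [NeZero N], N = L ^ K →
      ∀ (e : ℕ) (M : Fin (d + 1) → ℕ) [∀ μ, NeZero (M μ)], (∀ μ, M μ = 2 * L ^ e) →
      ∀ (msq : ℝ), 0 < msq → msq ≤ m0sq → ∀ (μ ν : Fin (d + 1)) (x y : Tor (fine N M)),
        |(N : ℝ) * ((N : ℝ) * (constrainedProp N M (aK a L K) (((N : ℕ) : ℝ) ^ 2) msq (x + unitVec (fine N M) μ) (y + unitVec (fine N M) ν)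
              - constrainedProp N M (aK a L K) (((N : ℕ) : ℝ) ^ 2) msq x (y + unitVec (fine N M) ν))
            - (N : ℝ) * (constrainedProp N M (aK a L K) (((N : ℕ) : ℝ) ^ 2) msq (x + unitVec (fine N M) μ) y
              - constrainedProp N M (aK a L K) (((N : ℕ) : ℝ) ^ 2) msq x y))|
          ≤ C * (∑ i ∈ Finset.range K, ((L : ℝ) ^ (d + 1) / (L : ℝ) ^ 2 * L * L) ^ i
              * Real.exp (-(δ * (tdistT (fine N M) x y * (L : ℝ) ^ i / (N : ℝ)))))
            * Real.exp (-(δ * tdistT M (blockOf N M x) (blockOf N M y))) := by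
  have hLr : (1 : ℝ) ≤ L := by exact_mod_cast (show 1 ≤ L by omega)
  obtain ⟨C₀, δ₀, hC₀, hδ₀, H⟩ := fullPropDD_profile_unif (d := d) L hLodd hL ha hm0
  refine ⟨C₀ * Real.exp (δ₀ / 2), δ₀ / 2, by positivity, by positivity, ?_⟩
  intro K hK N _ hN e M _ hM msq hmsq hcap μ ν x y
  have h := H K hK N hN e M hM msq hmsq hcap μ ν x y
  set Λ : ℝ := (L : ℝ) ^ (d + 1) / (L : ℝ) ^ 2 * L * L with hΛdef
  have hΛ : 0 ≤ Λ := by positivity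
  set r : ℝ := tdistT (fine N M) x y with hrdef
  set D : ℝ := tdistT M (blockOf N M x) (blockOf N M y) with hDdef
  have hN1 : (1 : ℝ) ≤ (N : ℝ) := by
    rw [hN]
    exact_mod_cast Nat.one_le_pow K L (by omega)
  have hD : (N : ℝ) * D ≤ r + ((N : ℝ) - 1) := mul_tdistT_blockOf_le N M x y
  have hsplit := levelSum_decay_split (K := K) hΛ hLr hδ₀.le (tdistT_nonneg _ x y) hN1 hD
  calc _ ≤ C₀ * ∑ i ∈ Finset.range K, Λ ^ i * Real.exp (-(δ₀ * (r * (L : ℝ) ^ i / (N : ℝ)))) := h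
    _ ≤ C₀ * (Real.exp (δ₀ / 2) * Real.exp (-(δ₀ / 2 * D))
          * ∑ i ∈ Finset.range K, Λ ^ i * Real.exp (-(δ₀ / 2 * (r * (L : ℝ) ^ i / (N : ℝ))))) :=
        mul_le_mul_of_nonneg_left hsplit hC₀.le
    _ = C₀ * Real.exp (δ₀ / 2) * (∑ i ∈ Finset.range K, Λ ^ i * Real.exp (-(δ₀ / 2 * (r * (L : ℝ) ^ i / (N : ℝ)))))
          * Real.exp (-(δ₀ / 2 * D)) := by ring

end Summit.QuantumFields.YangMills.BalabanUVNodes.N15KingModelRung.Curved
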